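import Summits.HodgeConjecture.HodgeConjecture.Theorems.Ring2HypothesesFlatSectionsCurveBase
import Summits.HodgeConjecture.HodgeConjecture.Theorems.AnchorTransportVariationalHodgeCurveBase
import Literature.AlgebraicGeometry.HodgeTheory.InvariantClassesFromTotalSpaceCurveBase
import Literature.AlgebraicGeometry.HodgeTheory.AlgebraicityLocusBoundary
import Literature.AlgebraicGeometry.Motives.CurveThroughTwoPointsProofs
import HarnessLib

/-!
# Ring 2 — hypotheses layer: `FlatSectionsAlgebraic ↔ VHC` BINDER-FREE, via curve bases (the partie fixe over affine curves is topological)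

HONEST FRAMING: research route conditional on HC_CM; not a corollary; Q11.4-sentence-2 already refuted in dim ≥ 3.

Cell `pub-hodge-ring2`, binder-prover seat `ring2-b04` (row b04 of `BINDER-OWNERS.md`:
`Ring2.Hypotheses.FlatSectionsAlgebraic`, Charles–Schnell Conj. 11.3.1 in flat-section form). `HC_CM`
(`Theses.RankFourFaces.CMAbelianHodge`) does not occur in this file; nothing here proves a case of the Hodge
conjecture — an equivalence between two typed OPEN inputs is proved. No definition, no named fact, no `sorry`.

## What this part adds

Up to now the row read «b04 ≡ b03 modulo c15»: `flatSectionsAlgebraic_iff_vhc_of_deligne1971`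
(`Ring2HypothesesFlatSectionsOfPartieFixe`, seat ring2-b01) needs the NAMED FACT
`HodgeTheory.deligne1971_invariantClass_fromTotalSpace_proper` (Deligne, *Hodge II*, Thm. 4.1.1 (i): the partie
fixe for PROPER smooth `f` over a smooth quasi-projective base), because the typed carrier
`Motives.IsSmoothProjectiveFamily` (proper `f`, smooth projective fibres) contains families whose total space
is not quasi-projective near some fibre, where Deligne 1968 / Voisin II Thm. 4.18 (the tree THEOREM
`deligne1968_invariantClass_fromTotalSpace_holds`) does not apply.

The fact is NOT needed. The flat-section node is local on the base and reduces to smooth irreducible AFFINE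
CURVE bases (`flatSectionsAlgebraic_of_curveBase`, `Ring2HypothesesFlatSectionsCurveBase`, granted Mumford's
two-point lemma — which is a tree THEOREM, `Motives.mumford_smoothCurve_through_two_points_holds`), and over a
smooth affine curve the partie fixe holds for EVERY smooth proper family with NO projectivity and NO Hodge
theory: `S(ℂ)` is a non-compact Riemann surface, of the homotopy type of a `1`-dimensional CW complex
(Andreotti–Frankel), so the Leray spectral sequence of the proper submersion `f(ℂ)` has the two columns
`p = 0, 1` and `Hᵏ(𝒳(ℂ); ℚ) → H⁰(S(ℂ), Rᵏf_*ℚ)` is onto — the tree THEOREM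
`HodgeTheory.invariantClass_fromTotalSpace_of_affineCurveBase` (`InvariantClassesFromTotalSpaceCurveBase`).

* `exists_globalSection_eq_of_flatSection_of_affineCurveBase` — over a smooth irreducible affine curve, a
  continuous section of the espace étalé `FiberClass f k → S(ℂ)` of ANY smooth projective family (total space
  arbitrary) is the section of ONE global class (the curve-base partie fixe at one point + the identity
  principle `Theorems.HeckePrymWeilLine.gcs_section_eq_of_eq` over the connected manifold `S(ℂ)`);
* `flatSection_algebraic_of_vhc_of_affineCurveBase` — hence `VHC` (item stmt-HodgeConjecture-1076) transports
  algebraicity of flat sections over smooth irreducible affine curves;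
* **`flatSectionsAlgebraic_of_vhc : VHC → FlatSectionsAlgebraic`** and
  **`flatSectionsAlgebraic_iff_vhc : FlatSectionsAlgebraic ↔ VHC`** — NO HYPOTHESIS: the flat-section form and
  the global-class form of Conj. 11.3.1 are ONE node in the full typed generality (all smooth irreducible bases,
  all smooth proper families with smooth projective fibres). Row b04 of `BINDER-OWNERS.md` now reads «≡ b03»
  outright; the C-row c15 leaves the row's path (it remains a correctly cited, unconsumed Literature fact);
* `flatSectionsAlgebraic_of_vhc_curveBase` — sharper: the flat-section form over every base follows from the
  GLOBAL-CLASS form over smooth irreducible affine CURVES alone (route AnchorTransport's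
  `Theorems.variationalHodge_of_curveBase`, Mumford's lemma discharged).

References: [CharlesSchnell2014Notes] F. Charles, C. Schnell, Notes on absolute Hodge classes (2014),
Conj. 11.3.1, Thm. 11.3.4, Prop. 11.3.5; [DeligneHodgeII1971] P. Deligne, Théorie de Hodge II, Publ. Math.
IHÉS 40 (1971), Thm. 4.1.1 (i); [VoisinHodgeII2003] C. Voisin, Hodge Theory and Complex Algebraic Geometry II
(2003), §1.2.2 Thm. 1.22, Lemma 4.17, Thm. 4.18; [MumfordAV1970] D. Mumford, Abelian Varieties (1970), §6 Lemma;
[AndreottiFrankel1959] A. Andreotti, T. Frankel, Ann. of Math. 69 (1959), 713–717.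
-/

-- every declaration of this problem lives in `Summit.HodgeConjecture.HodgeConjecture.…` (summit = sub-problem)
set_option linter.dupNamespace false

noncomputable section

open CategoryTheory AlgebraicGeometry Topology
open Literature.AlgebraicGeometry Literature.AlgebraicGeometry.Motives Literature.AlgebraicGeometry.HodgeTheory

namespace Summit.HodgeConjecture.HodgeConjecture.Ring2.Hypotheses

/-! ## §1 Over a smooth irreducible affine curve every flat section is the section of ONE global class -/

/-- **A flat section over a smooth irreducible affine CURVE is the section of one global class — for every
smooth projective family, total space arbitrary, no named fact.** Let `f : 𝒳 ⟶ S` be a smooth proper family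
with smooth projective fibres (`IsSmoothProjectiveFamily f n`) over an affine, irreducible `ℂ`-scheme `S`,
smooth over `ℂ` of topological Krull dimension `1` (the bases produced by Mumford's lemma,
`Motives.mumford_smoothCurve_through_two_points`; smooth of relative dimension `1` by
`HodgeTheory.isIntegral_and_smoothOfRelativeDimension_one`), and let `σ` be a continuous section of
`FiberClass.pt : FiberClass f k → S(ℂ)`. Then `σ = (s ↦ (s, β|_{𝒳_s}))` for ONE `β ∈ Hᵏ(𝒳(ℂ); ℂ)`: the
topological partie fixe over affine curves (`HodgeTheory.invariantClass_fromTotalSpace_of_affineCurveBase`: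
two-column Leray, Andreotti–Frankel) gives `β` with `σ s₀ = (s₀, β|_{𝒳_{s₀}})` at one point, and continuous
sections of the local system `Rᵏf_*ℂ` (Ehresmann over any smooth base,
`isCohomologicallyLocallyTrivialOn_univ_of_isSmoothProjectiveFamily_of_smooth`) over the path-connected manifold
`S(ℂ)` (`ComplexPoints.connectedSpace_iff_holds`, `pathConnectedSpace_complexPoints_of_smoothOfRelativeDimension`)
agreeing at one point agree everywhere (`Theorems.HeckePrymWeilLine.gcs_section_eq_of_eq`, Voisin II Lemma 4.17).
[cite: VoisinHodgeII2003, Thm. 4.18 and Lemma 4.17, with §1.2.2 Thm. 1.22]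
[cite: DeligneHodgeII1971, Théorème 4.1.1 (i) (the case of a curve base, proved topologically)] -/
theorem exists_globalSection_eq_of_flatSection_of_affineCurveBase {n : ℕ} {𝒳 S : SchemeOver ℂ}
    (f : 𝒳 ⟶ S) (hf : IsSmoothProjectiveFamily f n) [IsAffine S.left] [IrreducibleSpace S.left]
    [AlgebraicGeometry.Smooth S.hom] (hdim : topologicalKrullDim S.left = 1) (k : ℕ)
    {σ : ComplexPoints S → FiberClass f k} (hσ : Continuous σ) (hpt : ∀ s, (σ s).pt = s) :
    ∃ β : complexBetti 𝒳 k, ∀ s, σ s = globalSection f k β s := by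
  haveI : LocallyOfFiniteType S.hom := inferInstance
  haveI : SmoothOfRelativeDimension 1 S.hom := (isIntegral_and_smoothOfRelativeDimension_one S hdim).2
  haveI : ConnectedSpace (ComplexPoints S) := (ComplexPoints.connectedSpace_iff_holds S).2 inferInstance
  haveI := pathConnectedSpace_complexPoints_of_smoothOfRelativeDimension S 1
  have hU := isCohomologicallyLocallyTrivialOn_univ_of_isSmoothProjectiveFamily_of_smooth f hf
  obtain ⟨s₀⟩ := (inferInstance : Nonempty (ComplexPoints S))
  obtain ⟨β, hβ⟩ := invariantClass_fromTotalSpace_of_affineCurveBase f hf k σ hσ hpt s₀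
  exact ⟨β, Theorems.HeckePrymWeilLine.gcs_section_eq_of_eq f k hU hσ hpt (continuous_globalSection f k β)
    (fun _ => rfl) hβ⟩

/-! ## §2 `VHC` transports algebraicity of flat sections over affine curves; hence `FlatSectionsAlgebraic ↔ VHC` -/

/-- **Over a smooth irreducible affine curve, `VHC` transports algebraicity of flat sections of Hodge classes**
(total space arbitrary, no named fact): the flat section is the section of one global class `β` (§1), `β` is
fibrewise rational `(p,p)` because `σ` is valued in the locus of Hodge classes, and algebraic at the anchor, so
`VHC` (item stmt-HodgeConjecture-1076, a HYPOTHESIS) carries algebraicity to every fibre, i.e. to every value of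
`σ`. Kernel form of Charles–Schnell's "since `S` is connected, `α̃_s = i_s^*(a)` …" (proof of Prop. 11.3.5) on
the bases of Mumford's lemma. [cite: CharlesSchnell2014Notes, Conj. 11.3.1 and proof of Prop. 11.3.5] -/
theorem flatSection_algebraic_of_vhc_of_affineCurveBase (hV : Theses.AnchorTransport.VariationalHodge)
    ⦃n : ℕ⦄ ⦃𝒳 S : SchemeOver ℂ⦄ (f : 𝒳 ⟶ S) (hf : IsSmoothProjectiveFamily f n)
    (hirr : IrreducibleSpace S.left) (haff : IsAffine S.left) (hsm : AlgebraicGeometry.Smooth S.hom)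
    (hdim : topologicalKrullDim S.left = 1)
    (p : ℕ) (σ : ComplexPoints S → FiberClass f (2 * p)) (hσ : Continuous σ) (hpt : ∀ s, (σ s).pt = s)
    (hH : ∀ s, σ s ∈ locusOfHodgeClasses f n p)
    (h₀ : ∃ s₀, (σ s₀).cls ∈ algebraicClasses (fiberOver f (σ s₀).pt) p) (s : ComplexPoints S) :
    (σ s).cls ∈ algebraicClasses (fiberOver f (σ s).pt) p := by
  haveI := hirr
  haveI := haff
  haveI := hsm
  obtain ⟨s₀, hs₀⟩ := h₀
  obtain ⟨β, hσβ⟩ := exists_globalSection_eq_of_flatSection_of_affineCurveBase f hf hdim (2 * p) hσ hpt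
  have hA : ∀ t : ComplexPoints S, IsRationalClass (complexBetti.map (fiberι f t) (2 * p) β) ∧
      IsOfHodgeType n (fiberOver f t) (2 * p) p p (complexBetti.map (fiberι f t) (2 * p) β) := fun t =>
    fiberClass_transfer_of_eq_mk (hσβ t)
      (fun t c => IsRationalClass c ∧ IsOfHodgeType n (fiberOver f t) (2 * p) p p c)
      ((mem_locusOfHodgeClasses_iff _).1 (hH t))
  have hβ₀ : complexBetti.map (fiberι f s₀) (2 * p) β ∈ algebraicClasses (fiberOver f s₀) p :=
    fiberClass_transfer_of_eq_mk (hσβ s₀) (fun t c => c ∈ algebraicClasses (fiberOver f t) p) hs₀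
  exact fiberClass_transfer_to_eq_mk (hσβ s) (fun t c => c ∈ algebraicClasses (fiberOver f t) p)
    (hV f hf hirr hsm p β hA ⟨s₀, hβ₀⟩ s)

/-- **`VHC ⟹ FlatSectionsAlgebraic` over ALL smooth irreducible bases, BINDER-FREE** — the row-b04 arrow with
NO named fact: the flat-section node reduces to smooth irreducible affine curve bases
(`flatSectionsAlgebraic_of_curveBase`, seat ring2-b04 gen 1) granted Mumford's two-point lemma, which is the tree
THEOREM `Motives.mumford_smoothCurve_through_two_points_holds`, and over such bases `VHC` transports
(`flatSection_algebraic_of_vhc_of_affineCurveBase`). Supersedes `flatSectionsAlgebraic_of_deligne1971_of_vhc`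
(modulo Hodge II 4.1.1 (i)) and the rungs `flatSection_algebraic_of_vhc_of_isQuasiProjectiveOver` /
`…_of_locallyQuasiProjective` / `…_of_lefschetzClassAt` (all special cases). `HC_CM` plays no role; no case of
the Hodge conjecture is proved (an implication between typed open inputs). [cite: CharlesSchnell2014Notes, Conj. 11.3.1, Thm. 11.3.4 and Prop. 11.3.5]
[cite: MumfordAV1970, §6, Lemma] -/
theorem flatSectionsAlgebraic_of_vhc (hV : Theses.AnchorTransport.VariationalHodge) : FlatSectionsAlgebraic :=
  flatSectionsAlgebraic_of_curveBase mumford_smoothCurve_through_two_points_holds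
    (flatSection_algebraic_of_vhc_of_affineCurveBase hV)

/-- **The flat-section node and the global-class node are ONE node, with no hypothesis:
`FlatSectionsAlgebraic ↔ VHC`** (item stmt-HodgeConjecture-1076; `→` is part I's `vhc_of_flatSectionsAlgebraic`,
`←` is `flatSectionsAlgebraic_of_vhc`). In print (quasi-projective carriers, projective `π`) this is
Charles–Schnell's use of the global invariant cycle theorem (Thm. 11.3.4 / Prop. 11.3.5); in the typed generality
(proper `f`, arbitrary smooth irreducible base) the global invariant cycle theorem is needed only over affine
CURVES, where it is a theorem of topology. Row b04 of `BINDER-OWNERS.md` ≡ row b03 outright.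
[cite: CharlesSchnell2014Notes, Conj. 11.3.1 and Prop. 11.3.5] [cite: DeligneHodgeII1971, Théorème 4.1.1 (i)] -/
theorem flatSectionsAlgebraic_iff_vhc : FlatSectionsAlgebraic ↔ Theses.AnchorTransport.VariationalHodge :=
  ⟨vhc_of_flatSectionsAlgebraic, flatSectionsAlgebraic_of_vhc⟩

/-- **Sharper: the flat-section form over every base follows from the GLOBAL-CLASS form over smooth irreducible
affine CURVES alone** — route AnchorTransport's reduction `Theorems.variationalHodge_of_curveBase` (Mumford's
lemma, discharged by `Motives.mumford_smoothCurve_through_two_points_holds`) composed with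
`flatSectionsAlgebraic_of_vhc`. [cite: MumfordAV1970, §6, Lemma] [cite: CharlesSchnell2014Notes, Conj. 11.3.1] -/
theorem flatSectionsAlgebraic_of_vhc_curveBase
    (h : ∀ ⦃n : ℕ⦄ ⦃𝒳 S : SchemeOver ℂ⦄ (f : 𝒳 ⟶ S), IsSmoothProjectiveFamily f n →
      IrreducibleSpace S.left → IsAffine S.left → AlgebraicGeometry.Smooth S.hom →
      topologicalKrullDim S.left = 1 →
      ∀ (p : ℕ) (A : complexBetti 𝒳 (2 * p)),
      (∀ s : ComplexPoints S, IsRationalClass (complexBetti.map (fiberι f s) (2 * p) A) ∧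
        IsOfHodgeType n (fiberOver f s) (2 * p) p p (complexBetti.map (fiberι f s) (2 * p) A)) →
      (∃ s₀ : ComplexPoints S,
        complexBetti.map (fiberι f s₀) (2 * p) A ∈ algebraicClasses (fiberOver f s₀) p) →
      ∀ s : ComplexPoints S,
        complexBetti.map (fiberι f s) (2 * p) A ∈ algebraicClasses (fiberOver f s) p) :
    FlatSectionsAlgebraic :=
  flatSectionsAlgebraic_of_vhc
    (Theorems.variationalHodge_of_curveBase mumford_smoothCurve_through_two_points_holds h)

/-! ## Audit

No definition, no named fact, no `sorry`; `HC_CM` does not occur (the dictionary arrow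
`hc_av_of_hc_cm_of_mumfordTateCMAnchors_of_flatSectionsAlgebraic` of part I, fed `flatSectionsAlgebraic_of_vhc hV`,
is literally part I's `hc_av_of_hc_cm_of_mumfordTateCMAnchors_of_vhc` — nothing new to record).
`flatSectionsAlgebraic_iff_vhc` has NO hypothesis: its closure is the three standard axioms, through
the tree theorems `Motives.mumford_smoothCurve_through_two_points_holds` (Mumford's lemma),
`HodgeTheory.invariantClass_fromTotalSpace_of_affineCurveBase` (topological partie fixe over affine curves),
`ComplexPoints.connectedSpace_iff_holds` (SGA1 XII 2.4) and Ehresmann. -/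

#print axioms Summit.HodgeConjecture.HodgeConjecture.Ring2.Hypotheses.flatSectionsAlgebraic_of_vhc
#print axioms Summit.HodgeConjecture.HodgeConjecture.Ring2.Hypotheses.flatSectionsAlgebraic_iff_vhc
#print axioms Summit.HodgeConjecture.HodgeConjecture.Ring2.Hypotheses.flatSectionsAlgebraic_of_vhc_curveBase

end Summit.HodgeConjecture.HodgeConjecture.Ring2.Hypotheses

end
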